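import Mathlib
import Summits.AtomisticToContinuum.HydrodynamicLimit.Theorems.InformationPercolationEngineKickFairRelEquilibriumMesoDefs
import Literature.Analysis.FluidPDE.HardSphereTorusMeasure
import Literature.MathematicalPhysics.KineticTheory.GoodConfigurations
import HarnessLib

/-!
# `KickFairRelEquilibriumMeso`, line `kinetic-window-cut` (rev 5) — the torus packing bound

Prover file (`--supports stmt-AtomisticToContinuum-15177`, wave 1 of rev 5, lead c8) for the registered stub
`torusPacking_card_le` (+ its hard-sphere corollary `card_filter_euclidDist_le`) of the line `kinetic-window-cut` of the
crux `…Theses.InformationPercolationEngine.KickFairRelEquilibriumMeso`. It is the DETERMINISTIC packing input of the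
close-pair count (CPL) of the long-flight window cut: at a fixed grid time, the hard spheres (centres pairwise at
minimal-image distance `≥ ε`) whose centres lie within minimal-image distance `R` of a point of `𝕋³` number at most
`((2R + ε)/ε)³`, provided `R + ε < 1/2` (so that all balls involved are Euclidean charts of the torus).

Proof: the open minimal-image balls of radius `ε/2` about the points of an `ε`-separated finite set `S` are pairwise
disjoint (triangle inequality `torus_euclidDist_triangle`) and contained in the ball of radius `R + ε/2` about the
centre `x`; their Haar measures are the Lebesgue measures of the Euclidean balls (`Torus.volume_euclidDist_lt`,
radius `< 1/2`), which scale like the cube of the radius (`Measure.addHaar_ball`); additivity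
(`measure_biUnion_finset`) and monotonicity give `card S · (ε/2)³ ≤ (R + ε/2)³`.
-/

noncomputable section

open MeasureTheory Set Filter Topology
open scoped ENNReal Classical

namespace Summit.AtomisticToContinuum.HydrodynamicLimit.Theorems.KickFairRelEquilibriumMesoLine

open Literature.Analysis.FluidPDE Literature.MathematicalPhysics.KineticTheory

/-- **Packing bound on the flat torus.** If the points of a finite set `S ⊆ 𝕋³` are pairwise at minimal-image
distance `≥ ε > 0` and all lie within minimal-image distance `R` of a point `x`, with `R + ε < 1/2`, then
`card S ≤ ((2R + ε)/ε)³` (volume comparison of the disjoint balls of radius `ε/2` inside the ball of radius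
`R + ε/2`). [folklore] -/
theorem torusPacking_card_le : ∀ (ε R : ℝ), 0 < ε → 0 ≤ R → R + ε < 1 / 2 → ∀ (x : T3) (S : Finset T3),
    (∀ y ∈ S, ∀ y' ∈ S, y ≠ y' → ε ≤ Torus.euclidDist y y') → (∀ y ∈ S, Torus.euclidDist y x ≤ R) →
    (S.card : ℝ) ≤ ((2 * R + ε) / ε) ^ 3 := by
  intro ε R hε hR hRε x S hsep hclose
  -- the small balls and the big ball
  set B : T3 → Set T3 := fun y => {w | Torus.euclidDist w y < ε / 2} with hB
  set C : Set T3 := {w | Torus.euclidDist w x < R + ε / 2} with hC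
  have hε2 : ε / 2 < 1 / 2 := by linarith
  have hRε2 : R + ε / 2 < 1 / 2 := by linarith
  -- the small balls are Borel (the minimal-image distance is a measurable function)
  have hBm : ∀ y : T3, MeasurableSet (B y) := fun y =>
    measurableSet_lt (Torus.measurable_reprSym.comp (measurable_id.sub measurable_const)).norm measurable_const
  -- pairwise disjoint
  have hdisj : Set.PairwiseDisjoint (↑S : Set T3) B := by
    intro y hy y' hy' hne
    refine Set.disjoint_left.2 fun w hw hw' => ?_
    have h1 : Torus.euclidDist w y < ε / 2 := hw
    have h2 : Torus.euclidDist w y' < ε / 2 := hw'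
    have h3 := torus_euclidDist_triangle y w y'
    rw [Torus.euclidDist_comm y w] at h3
    have h4 := hsep y hy y' hy' hne
    linarith
  -- contained in the big ball
  have hsub : (⋃ y ∈ S, B y) ⊆ C := by
    intro w hw
    simp only [Set.mem_iUnion] at hw
    obtain ⟨y, hy, hwy⟩ := hw
    have h1 : Torus.euclidDist w y < ε / 2 := hwy
    have h2 := hclose y hy
    have h3 := torus_euclidDist_triangle w y x
    show Torus.euclidDist w x < R + ε / 2
    linarith
  -- volumes
  set V : ℝ≥0∞ := volume (Metric.ball (0 : EuclideanSpace ℝ (Fin 3)) 1) with hV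
  have hV0 : V ≠ 0 := (Metric.measure_ball_pos volume _ one_pos).ne'
  have hVtop : V ≠ ⊤ := measure_ball_lt_top.ne
  have hvolB : ∀ y : T3, volume (B y) = ENNReal.ofReal ((ε / 2) ^ 3) * V := by
    intro y
    rw [hB]
    dsimp only
    rw [Torus.volume_euclidDist_lt hε2, Measure.addHaar_ball volume _ (by positivity : (0 : ℝ) ≤ ε / 2),
      finrank_euclideanSpace, Fintype.card_fin]
  have hvolC : volume C = ENNReal.ofReal ((R + ε / 2) ^ 3) * V := by
    rw [hC, Torus.volume_euclidDist_lt hRε2, Measure.addHaar_ball volume _ (by positivity : (0 : ℝ) ≤ R + ε / 2),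
      finrank_euclideanSpace, Fintype.card_fin]
  have hsum : ∑ y ∈ S, volume (B y) = volume (⋃ y ∈ S, B y) :=
    (measure_biUnion_finset hdisj fun y _ => hBm y).symm
  have hle : (S.card : ℝ≥0∞) * (ENNReal.ofReal ((ε / 2) ^ 3) * V) ≤ ENNReal.ofReal ((R + ε / 2) ^ 3) * V := by
    calc (S.card : ℝ≥0∞) * (ENNReal.ofReal ((ε / 2) ^ 3) * V) = ∑ y ∈ S, volume (B y) := by
          rw [Finset.sum_congr rfl fun y _ => hvolB y, Finset.sum_const, nsmul_eq_mul]
      _ = volume (⋃ y ∈ S, B y) := hsum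
      _ ≤ volume C := measure_mono hsub
      _ = _ := hvolC
  rw [← mul_assoc, ENNReal.mul_le_mul_iff_left hV0 hVtop, ← ENNReal.ofReal_natCast,
    ← ENNReal.ofReal_mul (Nat.cast_nonneg _), ENNReal.ofReal_le_ofReal_iff (by positivity)] at hle
  have hε2pos : (0 : ℝ) < (ε / 2) ^ 3 := by positivity
  calc (S.card : ℝ) ≤ (R + ε / 2) ^ 3 / (ε / 2) ^ 3 := (le_div_iff₀ hε2pos).2 hle
    _ = ((2 * R + ε) / ε) ^ 3 := by
        rw [← div_pow]
        congr 1
        field_simp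

/-- **Packing bound for hard-sphere configurations.** In the hard-sphere domain of `N + 1` spheres of diameter
`ε > 0` on `𝕋³`, the labels whose centres lie within minimal-image distance `R` of a point `x` number at most
`((2R + ε)/ε)³`, provided `R + ε < 1/2` (distinct labels have distinct, `ε`-separated centres, so
`torusPacking_card_le` applies to the image of the label set under `j ↦ x_j`). [folklore] -/
theorem card_filter_euclidDist_le : ∀ (N : ℕ) (ε R : ℝ), 0 < ε → 0 ≤ R → R + ε < 1 / 2 →
    ∀ z : Phase N, z ∈ hardSphereDomain (Torus.geometry (Fin 3)) (N + 1) ε → ∀ x : T3,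
    (((Finset.univ.filter fun j : Fin (N + 1) => Torus.euclidDist (z j).1 x ≤ R).card : ℕ) : ℝ) ≤
      ((2 * R + ε) / ε) ^ 3 := by
  intro N ε R hε hR hRε z hz x
  set F : Finset (Fin (N + 1)) := Finset.univ.filter fun j : Fin (N + 1) => Torus.euclidDist (z j).1 x ≤ R with hF
  have hsep : ∀ j j' : Fin (N + 1), j ≠ j' → ε ≤ Torus.euclidDist (z j).1 (z j').1 := by
    intro j j' hjj'
    have h := hz j j' hjj'
    rwa [Torus.norm_geometry_sepVec] at h
  have hinj : Set.InjOn (fun j : Fin (N + 1) => (z j).1) (↑F : Set (Fin (N + 1))) := by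
    intro j _ j' _ hjj'
    by_contra hne
    have h := hsep j j' hne
    have h0 : Torus.euclidDist (z j).1 (z j').1 = 0 := by
      rw [show (z j).1 = (z j').1 from hjj', Torus.euclidDist_self]
    linarith
  have hcard : (F.image fun j : Fin (N + 1) => (z j).1).card = F.card := Finset.card_image_of_injOn hinj
  have key := torusPacking_card_le ε R hε hR hRε x (F.image fun j : Fin (N + 1) => (z j).1) ?_ ?_
  · rwa [hcard] at key
  · intro y hy y' hy' hne
    simp only [Finset.mem_image] at hy hy'
    obtain ⟨j, -, rfl⟩ := hy
    obtain ⟨j', -, rfl⟩ := hy'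
    exact hsep j j' fun h => hne (by rw [h])
  · intro y hy
    simp only [Finset.mem_image] at hy
    obtain ⟨j, hj, rfl⟩ := hy
    rw [hF, Finset.mem_filter] at hj
    exact hj.2

end Summit.AtomisticToContinuum.HydrodynamicLimit.Theorems.KickFairRelEquilibriumMesoLine

end
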